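import Summits.QuantumFields.BalabanUV.T4Continuum.Support.UrsellTermBudget
import Literature.MathematicalPhysics.QuantumFieldTheory.Balaban1983to89.B13FamilySum

/-!
# NE5 ∕ U3 — convergence of the ORDERED series (2.13), part 4: the DECAY RATE — `ClassBound M K W κ G` with `κ > 0` from a
# decaying activity majorant and the displayed geometric step (2.27)

Cell `pub-balaban`, unit `b2b-balaban-t4-ne5-formalise-leaf-08` (NE5 formalisation swarm, LEAF PROVER 08; row O1-d2 follower (iii);
parts 1–3 = `Support/UrsellTreeSum` p208810, `Support/UrsellSeriesBound` p209076, `Support/UrsellTermBudget` p209547).  Summits-side NEW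
WORK under the LEAN PLACEMENT RULE (cell bookkeeping).  HONEST FRAMING: rung (B)+1 of the FINITE-VOLUME T⁴ continuum programme — NOT
infinite volume, NOT a mass gap, NOT the Clay problem, NOT a proof of NE5.  HONEST DEPENDENCY (cell line, verbatim): continuum YM on
T⁴ ⇐ BetaPertH ∧ nine spine estimates (0/9 proved); BetaPertH ⇐ (D1) ∧ (D4) ∧ CAP+tail; G-an2-4 gates asym, D1 and NE2/3/4.

WHAT.  Part 3 discharged leaf-04's per-domain budget `∑' i, actMajorant … k X i ≤ G·e^{−κ d(X)}` (`B13TermRep.classBound_b13_of_actBound`,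
p208307) at decay rate `κ = 0`.  The printed rate ((2.41) p. 21: *"|𝐄^{(k+1)}(X)| ≤ O(1)C₃ε₁exp(−(1−10δ)½Lκd_{k+1}(X))"*) is EXTRACTED
inside the combinatorial sum from the decay of the activities along the geometric step (2.27) p. 18 (*"Σ_{Y∈D}(d_k(Y) + 5) ≥ d_k(Y₀) +
5"*) — (2.40).  This file performs that extraction over the socket, asserting nothing of [II]:
* §1 (ANY `TermIndexing`): if `A Z j ≤ A′ Z j · e^{−κ s(Z)}` factorwise (`κ ≥ 0`) and every tuple localizing at `X` has `L ≤ Σ_m s(poly i m)`,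
  then `actMajorant A k X i ≤ e^{−κL} · actMajorant A′ k X i` (`actMajorant_le_exp_mul`), hence summability transfers and
  `∑' actMajorant A ≤ B·e^{−κL}` from `∑' actMajorant A′ ≤ B` (`tsum_actMajorant_le_of_decay`); fired into leaf-04 BY NAME:
  **`classBound_b13_of_actBound_decay : … → ClassBound M K W κ G`** (the budget of the STRIPPED majorant `A′` and the displayed geometric
  binder `C.d X ≤ Σ_m s(poly i m)` give the rate);
* §2 (the socket on Bałaban's labels, `labelsIndexing G D` ∕ `touchInc G`, leaf-02 p208148): the geometric binder IS the tree's displayed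
  (2.27) shape `B13FamilySum.Ineq227 (G.level k) G.cubes C.d (G.cubes X) (C.d X) c` ([cite locus only]; the same hypothesis shape as
  `ClusterRepDecay.decayExtract_of_ineq227`) read on ORDERED covering tuples (`le_sum_polys_of_ineq227`: `d(X) + c ≤ Σ_m (d(Z_m) + c)`, the
  tuple's image is a covering family), and with part 3's budget for `A′`: **`classBound_b13_of_actNormDecay : … → ClassBound M K W κ
  (Φ′/(1 − 4νΦ′))`** from `𝒜 ≤ 𝒜′·e^{−κ(d(Z)+c)}`, (2.27), and the anchored exponential norm `Φ′` of `𝒜′` with `4νΦ′ < 1`.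
WHAT REMAINS DISPLAYED: the activity majorant itself with its decay and norm ((2.38)+(1.26)-KIND) and (2.27) (`Ineq227`, certified for
Bałaban's cubes by the b13 sub-cell as a SHAPE; its torus-geometry proof is `TreeLengthTorusGeometry`'s business, not this file's).
No definitions; 0 sorry; axioms ⊆ {propext, Classical.choice, Quot.sound}.
-/

noncomputable section

open Finset
open scoped BigOperators

namespace Summit.QuantumFields.BalabanUV.T4Continuum.UrsellTermDecay

open Literature.MathematicalPhysics.QuantumFieldTheory.Balaban1983to89.T4OutputRate (Carriers)
open Literature.MathematicalPhysics.QuantumFieldTheory.Balaban1983to89.T4InputCauchyRateData (StepModel)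
open Literature.MathematicalPhysics.QuantumFieldTheory.Balaban1983to89.T4InputCauchyRateSpecies (ClassBound)
open Literature.MathematicalPhysics.QuantumFieldTheory.Balaban1983to89.B13FamilySum (Ineq227 coveringFamilies mem_coveringFamilies)
open Summit.QuantumFields.BalabanUV.T4Continuum.ClusterRepOfDomains (DomainGeometry)
open Summit.QuantumFields.BalabanUV.T4Continuum.B13StepTermFamily (TermIndexing out)
open Summit.QuantumFields.BalabanUV.T4Continuum.B13StepTermLabels
open Summit.QuantumFields.BalabanUV.T4Continuum.B13StepTermSocket (labelsIndexing touchInc rel_iff)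
open Summit.QuantumFields.BalabanUV.T4Continuum.B13TermRep (actMajorant actMajorant_of_rel actMajorant_of_not_rel actMajorant_nonneg
  classBound_b13_of_actBound)
open Summit.QuantumFields.BalabanUV.T4Continuum.UrsellTreeSum (ind)
open Summit.QuantumFields.BalabanUV.T4Continuum.UrsellTermBudget (actSum summable_actMajorant tsum_actMajorant_le)

/-! ## §1 Decay extraction for ANY term indexing -/

section Generic

variable {C : Carriers} {ι P J : Type*} (𝒯 : TermIndexing C ι P J) (inc : P → P → Prop) [DecidableRel inc]

/-- [folklore] Factorwise decay `a m ≤ a′ m · e^{−κ s m}` and `L ≤ Σ_m s m` give `Π a ≤ e^{−κL} · Π a′` (`κ ≥ 0`, all factors nonnegative). -/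
theorem prod_le_exp_mul_prod {n : ℕ} {a a' s : Fin (n + 1) → ℝ} {κ L : ℝ} (hκ : 0 ≤ κ) (ha : ∀ m, 0 ≤ a m) (ha' : ∀ m, 0 ≤ a' m)
    (hdec : ∀ m, a m ≤ a' m * Real.exp (-(κ * s m))) (hL : L ≤ ∑ m, s m) :
    ∏ m, a m ≤ Real.exp (-(κ * L)) * ∏ m, a' m := by
  calc ∏ m, a m ≤ ∏ m, a' m * Real.exp (-(κ * s m)) := prod_le_prod (fun m _ => ha m) fun m _ => hdec m
    _ = (∏ m, a' m) * Real.exp (-(κ * ∑ m, s m)) := by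
        rw [prod_mul_distrib, ← Real.exp_sum, mul_sum, ← sum_neg_distrib]
    _ ≤ (∏ m, a' m) * Real.exp (-(κ * L)) :=
        mul_le_mul_of_nonneg_left (Real.exp_le_exp.2 (neg_le_neg (mul_le_mul_of_nonneg_left hL hκ))) (prod_nonneg fun m _ => ha' m)
    _ = Real.exp (-(κ * L)) * ∏ m, a' m := mul_comm _ _

variable {𝒯 inc}

/-- [folklore] **DECAY EXTRACTION, termwise** ((2.40)-shape): a factorwise decaying majorant `A ≤ A′·e^{−κ s}` and the geometric binder
`L ≤ Σ_m s(poly i m)` on the tuples localizing at `X` give `actMajorant A k X i ≤ e^{−κL} · actMajorant A′ k X i`. -/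
theorem actMajorant_le_exp_mul {A A' : P → J → ℝ} (hA : ∀ Z j, 0 ≤ A Z j) (hA' : ∀ Z j, 0 ≤ A' Z j) {s : P → ℝ} {κ : ℝ}
    (hκ : 0 ≤ κ) (hdec : ∀ Z j, A Z j ≤ A' Z j * Real.exp (-(κ * s Z))) {k : ℕ} {X : C.Dom} {L : ℝ}
    (hgeo : ∀ i, 𝒯.Rel k i X → L ≤ ∑ m, s (𝒯.poly i m)) (i : ι) :
    actMajorant 𝒯 inc A k X i ≤ Real.exp (-(κ * L)) * actMajorant 𝒯 inc A' k X i := by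
  by_cases h : 𝒯.Rel k i X
  · rw [actMajorant_of_rel h, actMajorant_of_rel h, mul_left_comm]
    exact mul_le_mul_of_nonneg_left
      (prod_le_exp_mul_prod hκ (fun m => hA _ _) (fun m => hA' _ _) (fun m => hdec _ _) (hgeo i h)) (norm_nonneg _)
  · rw [actMajorant_of_not_rel h, actMajorant_of_not_rel h, mul_zero]

/-- [folklore] Summability transfers from the stripped majorant `A′` to `A`. -/
theorem summable_actMajorant_of_decay {A A' : P → J → ℝ} (hA : ∀ Z j, 0 ≤ A Z j) (hA' : ∀ Z j, 0 ≤ A' Z j) {s : P → ℝ} {κ : ℝ}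
    (hκ : 0 ≤ κ) (hdec : ∀ Z j, A Z j ≤ A' Z j * Real.exp (-(κ * s Z))) {k : ℕ} {X : C.Dom} {L : ℝ}
    (hgeo : ∀ i, 𝒯.Rel k i X → L ≤ ∑ m, s (𝒯.poly i m)) (hs : Summable (actMajorant 𝒯 inc A' k X)) :
    Summable (actMajorant 𝒯 inc A k X) :=
  Summable.of_nonneg_of_le (actMajorant_nonneg hA k X) (actMajorant_le_exp_mul hA hA' hκ hdec hgeo) (hs.mul_left _)

/-- [folklore] **THE PER-DOMAIN BUDGET WITH RATE**: `∑' actMajorant A′ ≤ B ⟹ ∑' actMajorant A ≤ B·e^{−κL}`. -/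
theorem tsum_actMajorant_le_of_decay {A A' : P → J → ℝ} (hA : ∀ Z j, 0 ≤ A Z j) (hA' : ∀ Z j, 0 ≤ A' Z j) {s : P → ℝ} {κ : ℝ}
    (hκ : 0 ≤ κ) (hdec : ∀ Z j, A Z j ≤ A' Z j * Real.exp (-(κ * s Z))) {k : ℕ} {X : C.Dom} {L : ℝ}
    (hgeo : ∀ i, 𝒯.Rel k i X → L ≤ ∑ m, s (𝒯.poly i m)) (hs : Summable (actMajorant 𝒯 inc A' k X)) {B : ℝ}
    (hB : ∑' i, actMajorant 𝒯 inc A' k X i ≤ B) : ∑' i, actMajorant 𝒯 inc A k X i ≤ B * Real.exp (-(κ * L)) :=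
  calc ∑' i, actMajorant 𝒯 inc A k X i ≤ ∑' i, Real.exp (-(κ * L)) * actMajorant 𝒯 inc A' k X i :=
        Summable.tsum_le_tsum (actMajorant_le_exp_mul hA hA' hκ hdec hgeo) (summable_actMajorant_of_decay hA hA' hκ hdec hgeo hs)
          (hs.mul_left _)
    _ = Real.exp (-(κ * L)) * ∑' i, actMajorant 𝒯 inc A' k X i := tsum_mul_left
    _ ≤ Real.exp (-(κ * L)) * B := mul_le_mul_of_nonneg_left hB (Real.exp_nonneg _)
    _ = B * Real.exp (-(κ * L)) := mul_comm _ _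

variable (𝒯 inc) {Op Hist : Type*} [NormedAddCommGroup Op] [NormedSpace ℂ Op] [NormedAddCommGroup Hist] [NormedSpace ℂ Hist]
  (act : P → J → Op → Hist → ℂ)

/-- [folklore] **ROW O1-d3 WITH RATE, ANY TERM INDEXING** — leaf-04's `classBound_b13_of_actBound` fired with the extracted rate: for a step
model with `M.Out = out 𝒯 inc act`, (i) an activity majorant `A k g U` at the class points (displayed, (2.38)-KIND) which (ii) decays
factorwise against a STRIPPED majorant, `A k g U Z j ≤ A′ k g U Z j · e^{−κ s(Z)}`, (iii) the displayed geometric binder `C.d X ≤ Σ_m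
s(poly i m)` on the tuples localizing at each step-`k` domain ((2.27)-KIND) and (iv) a per-domain budget `G` for `A′` ⟹ `ClassBound M K W κ G`. -/
theorem classBound_b13_of_actBound_decay {M : StepModel C Op Hist} (hM : ∀ k o h X, M.Out k o h X = out 𝒯 inc act k o h X)
    {K : ℕ → (ℕ → ℝ) → C.BgB → Set (Op × Hist)} {W : Set (ℕ → ℝ)} {A A' : ℕ → (ℕ → ℝ) → C.BgB → P → J → ℝ} {κ G : ℝ}
    {s : P → ℝ} (hκ : 0 ≤ κ)
    (hA : ∀ k, ∀ g ∈ W, ∀ (U : C.BgB) (q : Op × Hist), q ∈ K k g U → ∀ X : C.Dom, C.scale X = k →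
      ∀ i, 𝒯.Rel k i X → ∀ m, ‖act (𝒯.poly i m) (𝒯.lab i m) q.1 q.2‖ ≤ A k g U (𝒯.poly i m) (𝒯.lab i m))
    (hA0 : ∀ k g U Z j, 0 ≤ A k g U Z j) (hA0' : ∀ k g U Z j, 0 ≤ A' k g U Z j)
    (hdec : ∀ k g U Z j, A k g U Z j ≤ A' k g U Z j * Real.exp (-(κ * s Z)))
    (hgeo : ∀ (k : ℕ) (X : C.Dom), C.scale X = k → ∀ i, 𝒯.Rel k i X → C.d X ≤ ∑ m, s (𝒯.poly i m))
    (hbud : ∀ k, ∀ g ∈ W, ∀ (U : C.BgB) (X : C.Dom), C.scale X = k →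
      Summable (actMajorant 𝒯 inc (A' k g U) k X) ∧ ∑' i, actMajorant 𝒯 inc (A' k g U) k X i ≤ G) :
    ClassBound M K W κ G :=
  classBound_b13_of_actBound hM hA fun k g hg U X hX =>
    ⟨summable_actMajorant_of_decay (hA0 k g U) (hA0' k g U) hκ (hdec k g U) (hgeo k X hX) (hbud k g hg U X hX).1,
      tsum_actMajorant_le_of_decay (hA0 k g U) (hA0' k g U) hκ (hdec k g U) (hgeo k X hX) (hbud k g hg U X hX).1
        (hbud k g hg U X hX).2⟩

end Generic

/-! ## §2 The socket on Bałaban's labels: the geometric binder IS the displayed (2.27), read on ordered covering tuples -/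

section Socket

variable {C : Carriers} [DecidableEq C.Dom] {Cube : Type*} [DecidableEq Cube] {Bnd : Type*} [DecidableEq Bnd]
  (G : DomainGeometry C Cube) (D : InnerData C Bnd)

/-- [folklore] **(2.27) ON ORDERED COVERING TUPLES**: if the step-`k` catalogue satisfies the displayed `Ineq227 (G.level k) G.cubes C.d
(G.cubes X) (C.d X) c` (*"Σ_{Y∈D}(d_k(Y) + c) ≥ d_k(X) + c"* over the covering FAMILIES of `X`'s footprint; `c ≥ 0`), then every ordered
tuple of step-`k` polymers covering `X` has `d(X) + c ≤ Σ_m (d(Z_m) + c)` — its image is a covering family, and repeated members only add. -/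
theorem le_sum_polys_of_ineq227 {c : ℝ} (hc : 0 ≤ c) {k : ℕ} {X : C.Dom}
    (h227 : Ineq227 (G.level k) G.cubes C.d (G.cubes X) (C.d X) c) {n : ℕ} {Z : Fin (n + 1) → C.Dom}
    (hZ : Z ∈ polyTuples G k X n) : C.d X + c ≤ ∑ m, (C.d (Z m) + c) := by
  obtain ⟨hlev, hcov⟩ := (mem_polyTuples G).1 hZ
  have hD : univ.image Z ∈ coveringFamilies (G.level k) G.cubes (G.cubes X) := by
    refine mem_coveringFamilies.2 ⟨fun Y hY => ?_, ?_⟩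
    · obtain ⟨m, -, rfl⟩ := mem_image.1 hY
      exact (hlev m).1
    · rw [image_biUnion]
      exact hcov
  calc C.d X + c ≤ ∑ Y ∈ univ.image Z, (C.d Y + c) := h227 _ hD
    _ ≤ ∑ m, (C.d (Z m) + c) := sum_image_le_of_nonneg fun m _ => add_nonneg (C.d_nonneg _) hc

/-- [folklore] The geometric binder of §1 for the socket instance, with `s Z := d(Z) + c` and `L := d(X)`, from the displayed (2.27). -/
theorem d_le_sum_polys_of_ineq227 {c : ℝ} (hc : 0 ≤ c) {k : ℕ} {X : C.Dom}
    (h227 : Ineq227 (G.level k) G.cubes C.d (G.cubes X) (C.d X) c) (i : TermIdx C.Dom Bnd)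
    (hi : (labelsIndexing G D).Rel k i X) : C.d X ≤ ∑ m, (C.d ((labelsIndexing G D).poly i m) + c) :=
  (le_add_of_nonneg_right hc).trans (le_sum_polys_of_ineq227 G hc h227 (polys_mem_polyTuples G D ((rel_iff G D).1 hi).2))

variable {Op Hist : Type*} [NormedAddCommGroup Op] [NormedSpace ℂ Op] [NormedAddCommGroup Hist] [NormedSpace ℂ Hist]

/-- [folklore] **ROW O1-d3 WITH THE PRINTED KIND OF RATE, ON THE SOCKET** ((2.41)-shape `|E(X)| ≤ G·e^{−κ d(X)}` on the class): for a step
model whose output is the B13 series on Bałaban's term labels, (i) a nonnegative activity-term majorant `𝒜 k g U` at the class points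
((2.38)-KIND, displayed) which (ii) decays factorwise, `𝒜 ≤ 𝒜′·e^{−κ(d(Z)+c)}` (`κ, c ≥ 0`), against a STRIPPED majorant `𝒜′` whose (iii)
anchored exponential norm on every step catalogue is `≤ Φ′` with `4νΦ′ < 1` (footprint-local reach `ν`), and (iv) the displayed (2.27)
`Ineq227 (G.level (scale X)) G.cubes C.d (G.cubes X) (C.d X) c` at every domain ⟹ **`ClassBound M K W κ (Φ′/(1 − 4νΦ′))`**. -/
theorem classBound_b13_of_actNormDecay (act : C.Dom → InnerLabel C.Dom Bnd → Op → Hist → ℂ) {M : StepModel C Op Hist}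
    (hM : ∀ k o h X, M.Out k o h X = out (labelsIndexing G D) (touchInc G) act k o h X)
    {K : ℕ → (ℕ → ℝ) → C.BgB → Set (Op × Hist)} {W : Set (ℕ → ℝ)}
    {𝒜 𝒜' : ℕ → (ℕ → ℝ) → C.BgB → C.Dom → InnerLabel C.Dom Bnd → ℝ} {κ c : ℝ} (hκ : 0 ≤ κ) (hc : 0 ≤ c)
    (hA : ∀ k, ∀ g ∈ W, ∀ (U : C.BgB) (q : Op × Hist), q ∈ K k g U → ∀ X : C.Dom, C.scale X = k →
      ∀ i : TermIdx C.Dom Bnd, (labelsIndexing G D).Rel k i X →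
        ∀ m, ‖act ((labelsIndexing G D).poly i m) ((labelsIndexing G D).lab i m) q.1 q.2‖ ≤
          𝒜 k g U ((labelsIndexing G D).poly i m) ((labelsIndexing G D).lab i m))
    (hA0 : ∀ k g U Z ℓ, 0 ≤ 𝒜 k g U Z ℓ) (hA0' : ∀ k g U Z ℓ, 0 ≤ 𝒜' k g U Z ℓ)
    (hdec : ∀ k g U Z ℓ, 𝒜 k g U Z ℓ ≤ 𝒜' k g U Z ℓ * Real.exp (-(κ * (C.d Z + c))))
    (h227 : ∀ X : C.Dom, Ineq227 (G.level (C.scale X)) G.cubes C.d (G.cubes X) (C.d X) c)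
    (reach : C.Dom → Finset Cube) {ν Φ' : ℝ} (hloc : ∀ Z Z', touchInc G Z' Z → ∃ q ∈ reach Z, q ∈ G.cubes Z') (hν : 0 ≤ ν)
    (hreach : ∀ Z, ((reach Z).card : ℝ) ≤ ν * (G.cubes Z).card) (hΦ0 : 0 ≤ Φ') (hsmall : 4 * ν * Φ' < 1)
    (hΦ : ∀ k, ∀ g ∈ W, ∀ (U : C.BgB) (q : Cube),
      ∑ Z ∈ G.level k, ind (q ∈ G.cubes Z) * actSum D (𝒜' k g U) k Z * Real.exp ((G.cubes Z).card) ≤ Φ') :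
    ClassBound M K W κ (Φ' / (1 - 4 * ν * Φ')) :=
  classBound_b13_of_actBound_decay (labelsIndexing G D) (touchInc G) act hM (s := fun Z => C.d Z + c) hκ hA hA0 hA0' hdec
    (fun _ X hX i hi => d_le_sum_polys_of_ineq227 G D hc (hX ▸ h227 X) i hi)
    fun k g hg U X _ =>
      ⟨summable_actMajorant G D (𝒜' k g U) reach (hA0' k g U) hloc hν hreach hΦ0 hsmall (hΦ k g hg U) X,
        tsum_actMajorant_le G D (𝒜' k g U) reach (hA0' k g U) hloc hν hreach hΦ0 hsmall (hΦ k g hg U) X⟩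

end Socket

end Summit.QuantumFields.BalabanUV.T4Continuum.UrsellTermDecay

end
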